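import Mathlib
import HarnessLib
import Literature.MathematicalPhysics.QuantumFieldTheory.YangMillsOS
import Literature.MathematicalPhysics.QuantumLattice.SchwartzTensor
import Summits.QuantumFields.YangMills.Theorems.HypercubicLimit.Negative.NonTrivialityBridge
import Summits.QuantumFields.YangMills.Theorems.LangevinControlUVOSLegsFromFemtoAndGapStubAssemblyNontrivial

/-!
# Closure helper for line `Sketch` (coupling response) of crux `HypercubicLimit`: the non-Gaussianity clause
# from a lattice third-cumulant floor

Sub-goal `nonGaussianClause_of_latticeFloor` (stmt-QuantumFields-16154, registered skeleton
`Cruxes/HypercubicLimit/Lines/Sketch.lean`).  If the lattice `n`-point functions of the renormalised curvature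
field converge to the one-field continuum family `S₁` on real off-diagonal tensors (the crux's convergence
clause, verbatim, for the one-field family) and, for ONE real triple `f, g, h` with pairwise disjoint supports,
the third-cumulant combination `κ₃ = S3 − S1·S2 − S1·S2 − S1·S2 + 2 S1 S1 S1` of LATTICE functions stays
`≥ δ > 0` in absolute value eventually along the scheme, then `S₁` satisfies the crux's non-Gaussianity clause:
take the complex tests `ofRealTest f, ofRealTest g, ofRealTest h` and the tensor witnesses
`SchwartzMap.tensorFin`, all off-diagonal by disjointness of supports (arity `1` automatically), pass to the
limit in `κ₃` (`n = 3, 2, 1` instances of the convergence clause), get `δ ≤ ‖κ₃(S₁)‖` and conclude `κ₃(S₁) ≠ 0`.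
-/

noncomputable section

open scoped SchwartzMap
open MeasureTheory Filter Topology
open Literature.MathematicalPhysics.AQFT Literature.MathematicalPhysics.QuantumLattice
open Literature.MathematicalPhysics.QuantumFieldTheory
open Summit.QuantumFields.YangMills.Theorems.OSLegsFromFemtoAndGap (isOffDiagonal_of_disjoint_three)

namespace Summit.QuantumFields.YangMills.Cruxes.HypercubicLimit.CouplingResponse

-- adapted from `Summit.QuantumFields.YangMills.Theorems.OSLegsFromFemtoAndGap.isOffDiagonal_of_disjoint_three`
-- (LangevinControlUVOSLegsFromFemtoAndGapStubAssemblyNontrivial.lean): the arity-2 case.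
/-- A real two-tensor `u ⊗ v` with disjoint supports lies in `⁰𝒮`: its support sits in
`tsupport u × tsupport v`, which misses the diagonal. [folklore] -/
theorem isOffDiagonal_of_disjoint_two {u v : 𝓢(EuclideanSpace ℝ (Fin 4), ℝ)}
    (huv : Disjoint (tsupport u) (tsupport v)) {T : 𝓢((Fin 2 → EuclideanSpace ℝ (Fin 4)), ℂ)}
    (hT : IsTensorOf T ![ofRealTest u, ofRealTest v]) : IsOffDiagonal T := by
  apply IsOffDiagonal.of_tsupport_subset
  set K : Set (Fin 2 → EuclideanSpace ℝ (Fin 4)) := {x | x 0 ∈ tsupport u ∧ x 1 ∈ tsupport v}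
  have hKc : IsClosed K :=
    ((isClosed_tsupport _).preimage (continuous_apply 0)).inter
      ((isClosed_tsupport _).preimage (continuous_apply 1))
  have hsub : Function.support (T : (Fin 2 → EuclideanSpace ℝ (Fin 4)) → ℂ) ⊆ K := by
    intro x hx
    rw [Function.mem_support, hT x] at hx
    simp only [Fin.prod_univ_two, Matrix.cons_val_zero, Matrix.cons_val_one, ofRealTest_apply] at hx
    refine ⟨subset_tsupport _ ?_, subset_tsupport _ ?_⟩
    · intro h; apply hx; simp [h]
    · intro h; apply hx; simp [h]
  refine (closure_minimal hsub hKc).trans ?_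
  rintro x ⟨hx0, hx1⟩ ⟨i, j, hij, hxij⟩
  fin_cases i <;> fin_cases j
  · exact hij rfl
  · exact Set.disjoint_left.1 huv hx0 (by simpa using hxij ▸ hx1)
  · exact Set.disjoint_left.1 huv (by simpa using hxij ▸ hx0) hx1
  · exact hij rfl

-- adapted from `Summit.QuantumFields.YangMills.Theorems.OSLegsFromFemtoAndGap.nonGaussian_of_lowerBounds`
-- (LangevinControlUVOSLegsFromFemtoAndGapStubAssemblyNontrivial.lean): same witnesses and limit passage, but
-- without centring (`S₁ 1 = 0` is not assumed), so all seven instances `n = 3, 2, 2, 2, 1, 1, 1` of the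
-- convergence clause enter and the full cumulant combination is passed to the limit; the floor is an eventual
-- `δ ≤ |κ₃|` along the scheme instead of a `(β, L)`-threshold bound.
/-- **Closure helper (non-Gaussianity).**  Under the crux's convergence clause for the one-field family `S₁` of
the renormalised curvature field, an eventual floor `δ > 0` under the absolute value of the third-cumulant
combination of LATTICE `n`-point functions on one real triple `f, g, h` with pairwise disjoint supports yields
the crux's non-Gaussianity clause for `S₁.toLabelled`, with the complex tests `ofRealTest f, ofRealTest g,
ofRealTest h` and the tensor witnesses `SchwartzMap.tensorFin`: the lattice combination converges to the
continuum one, whose norm is then `≥ δ`, hence non-zero. [folklore] -/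
theorem nonGaussianClause_of_latticeFloor : ∀ (G : Type) [Group G] [TopologicalSpace G] [IsTopologicalGroup G] [CompactSpace G] [MeasurableSpace G] [BorelSpace G] (r : LatticeRep G) (sch : SpeciesScheme (YMSpecies G)) (S₁ : SchwingerFamily (EuclideanSpace ℝ (Fin 4))), (∀ (n : ℕ), n ≠ 0 → ∀ (f : Fin n → 𝓢(EuclideanSpace ℝ (Fin 4), ℝ)) (F : 𝓢((Fin n → EuclideanSpace ℝ (Fin 4)), ℂ)), IsTensorOf F (fun i => ofRealTest (f i)) → IsOffDiagonal F → Tendsto (fun k : ℕ => ((latticeSchwinger r.ρ sch (fun s => s.F) k n (fun _ => r.curvature) f : ℝ) : ℂ)) atTop (𝓝 (S₁ n F))) → (∃ (f g h : 𝓢(EuclideanSpace ℝ (Fin 4), ℝ)) (δ : ℝ), Disjoint (tsupport f) (tsupport g) ∧ Disjoint (tsupport f) (tsupport h) ∧ Disjoint (tsupport g) (tsupport h) ∧ 0 < δ ∧ ∀ᶠ k in atTop, δ ≤ |latticeSchwinger r.ρ sch (fun s => s.F) k 3 (fun _ => r.curvature) ![f, g, h] - latticeSchwinger r.ρ sch (fun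 s => s.F) k 1 (fun _ => r.curvature) ![f] * latticeSchwinger r.ρ sch (fun s => s.F) k 2 (fun _ => r.curvature) ![g, h] - latticeSchwinger r.ρ sch (fun s => s.F) k 1 (fun _ => r.curvature) ![g] * latticeSchwinger r.ρ sch (fun s => s.F) k 2 (fun _ => r.curvature) ![f, h] - latticeSchwinger r.ρ sch (fun s => s.F) k 1 (fun _ => r.curvature) ![h] * latticeSchwinger r.ρ sch (fun s => s.F) k 2 (fun _ => r.curvature) ![f, g] + 2 * (latticeSchwinger r.ρ sch (fun s => s.F) k 1 (fun _ => r.curvature) ![f] * latticeSchwinger r.ρ sch (fun s => s.F) k 1 (fun _ => r.curvature) ![g] * latticeSchwinger r.ρ sch (fun s => s.F) k 1 (fun _ => r.curvature) ![h])|) → ∃ (f g h : 𝓢(EuclideanSpace ℝ (Fin 4), ℂ)) (Ffgh : 𝓢((Fin 3 → EuclideanSpace ℝ (Fin 4)), ℂ)) (Fgh Ffh Ffg : 𝓢((Fin 2 → EuclideanSpace ℝ (Fin 4)), ℂ)) (Ff Fg Fh : 𝓢((Fin 1 → EuclideanSpace ℝ (Fin 4)), ℂ)), IsTensorOf Ffgh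 ![f, g, h] ∧ IsOffDiagonal Ffgh ∧ IsTensorOf Fgh ![g, h] ∧ IsTensorOf Ffh ![f, h] ∧ IsTensorOf Ffg ![f, g] ∧ IsTensorOf Ff ![f] ∧ IsTensorOf Fg ![g] ∧ IsTensorOf Fh ![h] ∧ S₁.toLabelled 3 (fun _ => ()) Ffgh - S₁.toLabelled 1 (fun _ => ()) Ff * S₁.toLabelled 2 (fun _ => ()) Fgh - S₁.toLabelled 1 (fun _ => ()) Fg * S₁.toLabelled 2 (fun _ => ()) Ffh - S₁.toLabelled 1 (fun _ => ()) Fh * S₁.toLabelled 2 (fun _ => ()) Ffg + 2 * (S₁.toLabelled 1 (fun _ => ()) Ff * S₁.toLabelled 1 (fun _ => ()) Fg * S₁.toLabelled 1 (fun _ => ()) Fh) ≠ 0 := by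
  intro G _ _ _ _ _ _ r sch S₁ hconv hfloor
  obtain ⟨f, g, h, δ, hfg, hfh, hgh, hδ, hev⟩ := hfloor
  -- tensor witnesses
  set T3 : 𝓢((Fin 3 → EuclideanSpace ℝ (Fin 4)), ℂ) :=
    SchwartzMap.tensorFin 3 ![ofRealTest f, ofRealTest g, ofRealTest h]
  set Tgh : 𝓢((Fin 2 → EuclideanSpace ℝ (Fin 4)), ℂ) := SchwartzMap.tensorFin 2 ![ofRealTest g, ofRealTest h]
  set Tfh : 𝓢((Fin 2 → EuclideanSpace ℝ (Fin 4)), ℂ) := SchwartzMap.tensorFin 2 ![ofRealTest f, ofRealTest h]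
  set Tfg : 𝓢((Fin 2 → EuclideanSpace ℝ (Fin 4)), ℂ) := SchwartzMap.tensorFin 2 ![ofRealTest f, ofRealTest g]
  set Tf : 𝓢((Fin 1 → EuclideanSpace ℝ (Fin 4)), ℂ) := SchwartzMap.tensorFin 1 ![ofRealTest f]
  set Tg : 𝓢((Fin 1 → EuclideanSpace ℝ (Fin 4)), ℂ) := SchwartzMap.tensorFin 1 ![ofRealTest g]
  set Th : 𝓢((Fin 1 → EuclideanSpace ℝ (Fin 4)), ℂ) := SchwartzMap.tensorFin 1 ![ofRealTest h]
  have hT3 : IsTensorOf T3 ![ofRealTest f, ofRealTest g, ofRealTest h] := isTensorOf_tensorFin _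
  have hTgh : IsTensorOf Tgh ![ofRealTest g, ofRealTest h] := isTensorOf_tensorFin _
  have hTfh : IsTensorOf Tfh ![ofRealTest f, ofRealTest h] := isTensorOf_tensorFin _
  have hTfg : IsTensorOf Tfg ![ofRealTest f, ofRealTest g] := isTensorOf_tensorFin _
  have hTf : IsTensorOf Tf ![ofRealTest f] := isTensorOf_tensorFin _
  have hTg : IsTensorOf Tg ![ofRealTest g] := isTensorOf_tensorFin _
  have hTh : IsTensorOf Th ![ofRealTest h] := isTensorOf_tensorFin _
  -- the same witnesses in the shape `fun i => ofRealTest (![…] i)` of the convergence clause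
  have e3 : ∀ a b c : 𝓢(EuclideanSpace ℝ (Fin 4), ℝ),
      (fun i => ofRealTest (![a, b, c] i)) = ![ofRealTest a, ofRealTest b, ofRealTest c] := by
    intro a b c; funext i; fin_cases i <;> rfl
  have e2 : ∀ a b : 𝓢(EuclideanSpace ℝ (Fin 4), ℝ),
      (fun i => ofRealTest (![a, b] i)) = ![ofRealTest a, ofRealTest b] := by
    intro a b; funext i; fin_cases i <;> rfl
  have e1 : ∀ a : 𝓢(EuclideanSpace ℝ (Fin 4), ℝ), (fun i => ofRealTest (![a] i)) = ![ofRealTest a] := by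
    intro a; funext i; fin_cases i; rfl
  -- off-diagonality from pairwise disjoint supports; arity 1 is automatic (no distinct indices in `Fin 1`)
  have hod1 : ∀ F : 𝓢((Fin 1 → EuclideanSpace ℝ (Fin 4)), ℂ), IsOffDiagonal F := by
    rintro F x ⟨i, j, hij, -⟩
    exact absurd (Subsingleton.elim i j) hij
  have hod3 : IsOffDiagonal T3 := isOffDiagonal_of_disjoint_three hfg hgh hfh hT3
  have hodgh : IsOffDiagonal Tgh := isOffDiagonal_of_disjoint_two hgh hTgh
  have hodfh : IsOffDiagonal Tfh := isOffDiagonal_of_disjoint_two hfh hTfh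
  have hodfg : IsOffDiagonal Tfg := isOffDiagonal_of_disjoint_two hfg hTfg
  -- the seven instances of the convergence clause
  have c3 := hconv 3 (by norm_num) ![f, g, h] T3 ((e3 f g h).symm ▸ hT3) hod3
  have cgh := hconv 2 two_ne_zero ![g, h] Tgh ((e2 g h).symm ▸ hTgh) hodgh
  have cfh := hconv 2 two_ne_zero ![f, h] Tfh ((e2 f h).symm ▸ hTfh) hodfh
  have cfg := hconv 2 two_ne_zero ![f, g] Tfg ((e2 f g).symm ▸ hTfg) hodfg
  have cf := hconv 1 one_ne_zero ![f] Tf ((e1 f).symm ▸ hTf) (hod1 _)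
  have cg := hconv 1 one_ne_zero ![g] Tg ((e1 g).symm ▸ hTg) (hod1 _)
  have ch := hconv 1 one_ne_zero ![h] Th ((e1 h).symm ▸ hTh) (hod1 _)
  refine ⟨ofRealTest f, ofRealTest g, ofRealTest h, T3, Tgh, Tfh, Tfg, Tf, Tg, Th, hT3, hod3, hTgh, hTfh, hTfg,
    hTf, hTg, hTh, ?_⟩
  show S₁ 3 T3 - S₁ 1 Tf * S₁ 2 Tgh - S₁ 1 Tg * S₁ 2 Tfh - S₁ 1 Th * S₁ 2 Tfg + 2 * (S₁ 1 Tf * S₁ 1 Tg * S₁ 1 Th) ≠ 0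
  -- the lattice cumulant combination converges to the continuum one
  have hT : Tendsto (fun k : ℕ =>
      ((latticeSchwinger r.ρ sch (fun s => s.F) k 3 (fun _ => r.curvature) ![f, g, h] -
        latticeSchwinger r.ρ sch (fun s => s.F) k 1 (fun _ => r.curvature) ![f] *
          latticeSchwinger r.ρ sch (fun s => s.F) k 2 (fun _ => r.curvature) ![g, h] -
        latticeSchwinger r.ρ sch (fun s => s.F) k 1 (fun _ => r.curvature) ![g] *
          latticeSchwinger r.ρ sch (fun s => s.F) k 2 (fun _ => r.curvature) ![f, h] -
        latticeSchwinger r.ρ sch (fun s => s.F) k 1 (fun _ => r.curvature) ![h] *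
          latticeSchwinger r.ρ sch (fun s => s.F) k 2 (fun _ => r.curvature) ![f, g] +
        2 * (latticeSchwinger r.ρ sch (fun s => s.F) k 1 (fun _ => r.curvature) ![f] *
          latticeSchwinger r.ρ sch (fun s => s.F) k 1 (fun _ => r.curvature) ![g] *
            latticeSchwinger r.ρ sch (fun s => s.F) k 1 (fun _ => r.curvature) ![h]) : ℝ) : ℂ)) atTop
      (𝓝 (S₁ 3 T3 - S₁ 1 Tf * S₁ 2 Tgh - S₁ 1 Tg * S₁ 2 Tfh - S₁ 1 Th * S₁ 2 Tfg +
        2 * (S₁ 1 Tf * S₁ 1 Tg * S₁ 1 Th))) :=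
    ((((c3.sub (cf.mul cgh)).sub (cg.mul cfh)).sub (ch.mul cfg)).add
      (((cf.mul cg).mul ch).const_mul 2)).congr fun k => by push_cast; ring
  -- hence so do the absolute values, and the floor passes to the limit
  have hN : Tendsto (fun k : ℕ =>
      |latticeSchwinger r.ρ sch (fun s => s.F) k 3 (fun _ => r.curvature) ![f, g, h] -
        latticeSchwinger r.ρ sch (fun s => s.F) k 1 (fun _ => r.curvature) ![f] *
          latticeSchwinger r.ρ sch (fun s => s.F) k 2 (fun _ => r.curvature) ![g, h] -
        latticeSchwinger r.ρ sch (fun s => s.F) k 1 (fun _ => r.curvature) ![g] *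
          latticeSchwinger r.ρ sch (fun s => s.F) k 2 (fun _ => r.curvature) ![f, h] -
        latticeSchwinger r.ρ sch (fun s => s.F) k 1 (fun _ => r.curvature) ![h] *
          latticeSchwinger r.ρ sch (fun s => s.F) k 2 (fun _ => r.curvature) ![f, g] +
        2 * (latticeSchwinger r.ρ sch (fun s => s.F) k 1 (fun _ => r.curvature) ![f] *
          latticeSchwinger r.ρ sch (fun s => s.F) k 1 (fun _ => r.curvature) ![g] *
            latticeSchwinger r.ρ sch (fun s => s.F) k 1 (fun _ => r.curvature) ![h])|) atTop
      (𝓝 ‖S₁ 3 T3 - S₁ 1 Tf * S₁ 2 Tgh - S₁ 1 Tg * S₁ 2 Tfh - S₁ 1 Th * S₁ 2 Tfg +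
        2 * (S₁ 1 Tf * S₁ 1 Tg * S₁ 1 Th)‖) := by
    simpa only [Complex.norm_real, Real.norm_eq_abs] using hT.norm
  have hge : δ ≤ ‖S₁ 3 T3 - S₁ 1 Tf * S₁ 2 Tgh - S₁ 1 Tg * S₁ 2 Tfh - S₁ 1 Th * S₁ 2 Tfg +
      2 * (S₁ 1 Tf * S₁ 1 Tg * S₁ 1 Th)‖ :=
    ge_of_tendsto hN hev
  intro h0
  rw [h0, norm_zero] at hge
  exact absurd hge (not_le.2 hδ)

end Summit.QuantumFields.YangMills.Cruxes.HypercubicLimit.CouplingResponse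

end
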